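import Literature.Topology.FourManifolds.MilnorBoxDynamics
import Literature.Topology.FourManifolds.FlowFibreMorseData
import HarnessLib

/-!
# Flow geometry of a `2`-handle tube: first integrals, reaching the level backwards, and the
# non-hitting set (Milnor 1965, proof of Thm. 3.12; Gay–Kirby 2016, §4)

Topic `Literature/Topology/FourManifolds`; step E3b of a Morse-theoretic construction of
Gay–Kirby's trisection for the fact seat
`provefact-Literature.Topology.FourManifolds.exists_isBalancedGKTrisection` (Gay–Kirby 2016,
Thm. 4 via §4, Lemma 14).  Everything in this file is **proved**; there are no new definitions
beyond abbreviations.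

Setting: a Milnor box `D` (`Literature.Topology.FourManifolds.MilnorBox`) of index `2` about a
critical point `c` of `f` on a `4`-manifold, for a field `X` with global flow `θ`
(`IsFlowOf`); centred coordinates `u = (x⃗, y⃗) ∈ ℝ² × ℝ²`, `A = |x⃗|²`, `B = |y⃗|²`,
`f = f c - A + B`.  Milnor (1965, proof of Thm. 3.12): the trajectories in the box are
`(e^{-t} x⃗, e^{t} y⃗)`.  Consequences proved here:

* `IsFlowOf.apply_coord_eq_of_firstIntegral` — a function `G` of the coordinates with
  `DG(u)(-x⃗, y⃗) = 0` off the plane `x⃗ = 0` is constant along orbit segments inside the chart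
  domain (applied to Gay–Kirby's tube function `𝒯`, `TubeModel.fderiv_tube_milnorModelField`,
  and to `P = A·B`);
* `MilnorBox.exists_backward_level` — **reaching the level backwards**: a point of the chart
  domain with `A > 0`, `f ≥ f c - η` and `B ≤ B_max`, `η + B_max < ε²`, flows backwards, inside
  the closed box, to the level `f = f c - η` (first backward exit is through the face `A = ε²`,
  where `f < f c - η`; intermediate value theorem);
* `MilnorBox.not_hits_of_sqSumLT_eq_zero` / consequences — points of the unstable disc
  `x⃗ = 0` never reach the level `f c - η` (`f ≥ f c` along their backward orbit).

These are the geometric inputs for reading the lifted Heegaard function `φ̄` of the trisection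
in the `2`-handle charts (step E3 of the construction).

## References

* J. Milnor, *Lectures on the h-cobordism theorem* (1965), Def. 3.1, proof of Thm. 3.12
  (PDF p. 18). [MilnorHCobordism1965]
* D. Gay, R. Kirby, *Trisecting 4-manifolds*, Geom. Topol. 20 (2016), §4, Lemma 14. [GayKirby2016]
-/

open scoped Manifold ContDiff Topology
open Set Function Filter Metric

noncomputable section

universe u

namespace Literature.Topology.FourManifolds

open Flow

/-- Local notation: `𝔼 n` is the model Euclidean space `EuclideanSpace ℝ (Fin n)`. -/
local notation "𝔼 " n:arg => EuclideanSpace ℝ (Fin n)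

variable {M : Type u} [TopologicalSpace M] [ChartedSpace (𝔼 4) M]
  {f : M → ℝ} {X : Π x : M, TangentSpace (𝓡 4) x} {θ : ℝ × M → M} {c : M}

/-! ### Coordinates of an index-`2` box on a `4`-manifold -/

/-- `A = |x⃗|² = u₀² + u₁²` for index `2`. [cite: MilnorHCobordism1965, Def. 3.1] -/
theorem sqSumLT_two_apply (u : 𝔼 4) : sqSumLT 2 u = u 0 ^ 2 + u 1 ^ 2 := by
  simp only [sqSumLT]
  have : (Finset.univ.filter fun i : Fin 4 => (i : ℕ) < 2) = {0, 1} := by decide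
  rw [this, Finset.sum_pair (by decide)]

/-- `B = |y⃗|² = u₂² + u₃²` for index `2`. [cite: MilnorHCobordism1965, Def. 3.1] -/
theorem sqSumGE_two_apply (u : 𝔼 4) : sqSumGE 2 u = u 2 ^ 2 + u 3 ^ 2 := by
  simp only [sqSumGE]
  have : (Finset.univ.filter fun i : Fin 4 => 2 ≤ (i : ℕ)) = {2, 3} := by decide
  rw [this, Finset.sum_pair (by decide)]

/-- `A = |π u|²` in the notation of `TrisectionsTubeModel`. [folklore] -/
theorem sqSumLT_two_eq_nsq (u : 𝔼 4) : sqSumLT 2 u = TubeModel.nsq (RadialThickening.proj u) := by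
  rw [sqSumLT_two_apply, TubeModel.nsq_proj]

/-- `B = bsq u` in the notation of `TrisectionsRadialThickening`. [folklore] -/
theorem sqSumGE_two_eq_bsq (u : 𝔼 4) : sqSumGE 2 u = RadialThickening.bsq u := by
  rw [sqSumGE_two_apply, RadialThickening.bsq_apply]

/-! ### First integrals along orbit segments in the chart -/

/-- **A first integral of the model field is constant along orbit segments in the chart
domain.**  If `G : ℝ⁴ → ℝ` is differentiable with `DG(u)(F₂ u) = 0` at every `u` with
`x⃗ ≠ 0`, `D` is an index-`2` box, and the orbit of `p` stays in the chart domain on `[s, t]`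
with `A(θ(s, p)) > 0`, then `G(coord θ(t, p)) = G(coord θ(s, p))`.
[cite: MilnorHCobordism1965, proof of Thm. 3.12 (PDF p. 18)] -/
theorem IsFlowOf.apply_coord_eq_of_firstIntegral (h : IsFlowOf (𝓡 4) X θ) (D : MilnorBox (𝓡 4) f X c)
    (hk : D.k = 2) {G : 𝔼 4 → ℝ}
    (hG : ∀ u : 𝔼 4, TubeModel.nsq (RadialThickening.proj u) ≠ 0 →
      DifferentiableAt ℝ G u ∧ fderiv ℝ G u (milnorModelField 2 u) = 0)
    {p : M} {s t : ℝ} (hst : s ≤ t) (hsrc : ∀ r ∈ Icc s t, θ (r, p) ∈ D.chart.source)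
    (hA : 0 < sqSumLT D.k (D.coord (θ (s, p)))) :
    G (D.coord (θ (t, p))) = G (D.coord (θ (s, p))) := by
  -- `A > 0` along the segment
  have hApos : ∀ r ∈ Icc s t, 0 < sqSumLT D.k (D.coord (θ (r, p))) := by
    intro r hr
    have := h.sqSumLT_coord_eq_exp D hr.1 fun r' hr' => hsrc r' ⟨hr'.1, hr'.2.trans hr.2⟩
    rw [this]
    exact mul_pos (Real.exp_pos _) hA
  have hderiv : ∀ r ∈ Icc s t, HasDerivAt (fun r => G (D.coord (θ (r, p)))) 0 r := by
    intro r hr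
    have hne : TubeModel.nsq (RadialThickening.proj (D.coord (θ (r, p)))) ≠ 0 := by
      rw [← sqSumLT_two_eq_nsq, ← hk]; exact (hApos r hr).ne'
    obtain ⟨hd, h0⟩ := hG _ hne
    have h1 := hd.hasFDerivAt.comp_hasDerivAt r (h.hasDerivAt_coord D (hsrc r hr))
    rw [hk, h0] at h1
    exact h1
  exact constant_of_has_deriv_right_zero
    (fun r hr => (hderiv r hr).continuousAt.continuousWithinAt)
    (fun r hr => (hderiv r (Ico_subset_Icc_self hr)).hasDerivWithinAt) t (right_mem_Icc.2 hst)

/-- **Gay–Kirby's tube function is a first integral**: `𝒯(coord θ(t, p)) = 𝒯(coord θ(s, p))`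
along orbit segments in the chart domain with `A > 0`. [cite: GayKirby2016, §4, Lemma 14]
[cite: MilnorHCobordism1965, proof of Thm. 3.12] -/
theorem IsFlowOf.tube_coord_eq (h : IsFlowOf (𝓡 4) X θ) (D : MilnorBox (𝓡 4) f X c) (hk : D.k = 2)
    (ε κ η : ℝ) {p : M} {s t : ℝ} (hst : s ≤ t) (hsrc : ∀ r ∈ Icc s t, θ (r, p) ∈ D.chart.source)
    (hA : 0 < sqSumLT D.k (D.coord (θ (s, p)))) :
    TubeModel.tube ε κ η (D.coord (θ (t, p))) = TubeModel.tube ε κ η (D.coord (θ (s, p))) :=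
  h.apply_coord_eq_of_firstIntegral D hk (fun _ hu =>
    ⟨(TubeModel.contDiffAt_tube (m := 1) ε κ η hu).differentiableAt one_ne_zero,
      TubeModel.fderiv_tube_milnorModelField ε κ η hu⟩) hst hsrc hA

/-- **`P = A·B` is conserved** along orbit segments in the chart domain (the hyperbolas
`(e^{-t} x⃗, e^{t} y⃗)`). [cite: MilnorHCobordism1965, proof of Thm. 3.12 (PDF p. 18)] -/
theorem IsFlowOf.sqSumLT_mul_sqSumGE_coord_eq (h : IsFlowOf (𝓡 4) X θ) (D : MilnorBox (𝓡 4) f X c)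
    {p : M} {s t : ℝ} (hst : s ≤ t) (hsrc : ∀ r ∈ Icc s t, θ (r, p) ∈ D.chart.source) :
    sqSumLT D.k (D.coord (θ (t, p))) * sqSumGE D.k (D.coord (θ (t, p))) =
      sqSumLT D.k (D.coord (θ (s, p))) * sqSumGE D.k (D.coord (θ (s, p))) := by
  rw [h.sqSumLT_coord_eq_exp D hst hsrc, h.sqSumGE_coord_eq_exp D hst hsrc]
  have : Real.exp (-2 * (t - s)) * Real.exp (2 * (t - s)) = 1 := by
    rw [← Real.exp_add]; simp
  calc Real.exp (-2 * (t - s)) * sqSumLT D.k (D.coord (θ (s, p))) *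
        (Real.exp (2 * (t - s)) * sqSumGE D.k (D.coord (θ (s, p))))
      = (Real.exp (-2 * (t - s)) * Real.exp (2 * (t - s))) *
          (sqSumLT D.k (D.coord (θ (s, p))) * sqSumGE D.k (D.coord (θ (s, p)))) := by ring
    _ = _ := by rw [this, one_mul]

/-! ### Reaching the level backwards -/

namespace MilnorBox

/-- `f = f c - A + B` on the chart domain. [cite: MilnorHCobordism1965, Def. 3.1] -/
theorem apply_eq_sub_add (D : MilnorBox (𝓡 4) f X c) {z : M} (hz : z ∈ D.chart.source) :
    f z = f c - sqSumLT D.k (D.coord z) + sqSumGE D.k (D.coord z) := by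
  rw [D.apply_eq z hz, milnorQuadratic_eq]
  simp only [MilnorBox.coord]
  ring

/-- **Reaching the level backwards.**  Let `z` be a point of the chart domain of an index-`2`
box with `A(z) > 0`, `f z ≥ f c - η`, `B(z) ≤ B_max`, where `0 < η` and `η + B_max < ε²`.  Then
at some time `t ≤ 0` the orbit is on the level `f = f c - η`, having stayed in the closed box
`{A ≤ ε², B ≤ 4ε²}` (inside the chart domain) on `[t, 0]`.  (Backwards, `A` grows like `e^{2|t|}`
and `B` decays, so the orbit leaves the box through the face `A = ε²`, where
`f = f c - ε² + B < f c - η`; the level is crossed before, by the intermediate value theorem.)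
[cite: MilnorHCobordism1965, proof of Thm. 3.12 (PDF p. 18)] [cite: GayKirby2016, §4] -/
theorem exists_backward_level [T2Space M] (D : MilnorBox (𝓡 4) f X c) (h : IsFlowOf (𝓡 4) X θ)
    (hf : Continuous f) {η Bmax : ℝ} (hη : 0 < η) (hsmall : η + Bmax < D.ε ^ 2) {z : M}
    (hz : z ∈ D.chart.source) (hA : 0 < sqSumLT D.k (D.coord z)) (hfz : f c - η ≤ f z)
    (hB : sqSumGE D.k (D.coord z) ≤ Bmax) :
    ∃ t ≤ 0, (∀ r ∈ Icc t 0, θ (r, z) ∈ {q' | q' ∈ D.chart.source ∧ sqSumLT D.k (D.coord q') ≤ D.ε ^ 2 ∧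
        sqSumGE D.k (D.coord q') ≤ 4 * D.ε ^ 2}) ∧ f (θ (t, z)) = f c - η := by
  have hε := D.eps_pos
  set A₀ := sqSumLT D.k (D.coord z) with hA₀
  set B₀ := sqSumGE D.k (D.coord z) with hB₀
  have hBmax : B₀ ≤ Bmax := hB
  have hB0nn : 0 ≤ B₀ := sqSumGE_nonneg _ _
  -- `z` is in the box
  have hAz : A₀ < D.ε ^ 2 := by
    have h1 : f z = f c - A₀ + B₀ := D.apply_eq_sub_add hz
    nlinarith
  have hBz : B₀ < 4 * D.ε ^ 2 := by nlinarith
  have hzbox : z ∈ D.box := ⟨hz, hAz, hBz⟩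
  -- the backward orbit cannot stay in the box on `[-s*, 0]`, `s* = ε²/(2A₀)`… use `e^{2s} ≥ 1 + 2s`
  set sstar : ℝ := D.ε ^ 2 / (2 * A₀) with hsstar
  have hsstar0 : 0 ≤ sstar := by positivity
  have hexit : ∃ s ∈ Icc 0 sstar, θ (-s, z) ∉ D.box := by
    by_contra hall
    push Not at hall
    have hsrc : ∀ r ∈ Icc (-sstar) 0, θ (r, z) ∈ D.chart.source := fun r hr => by
      have := (hall (-r) ⟨by linarith [hr.2], by linarith [hr.1]⟩).1
      simpa using this
    have hform := h.sqSumLT_coord_eq_exp D (neg_nonpos.2 hsstar0) hsrc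
    -- `A(0) = e^{-2 s*} A(-s*)`, i.e. `A(-s*) = e^{2s*} A₀ ≥ (1 + 2 s*) A₀ = A₀ + ε²`
    rw [h.map_zero] at hform
    have hAstar : sqSumLT D.k (D.coord (θ (-sstar, z))) = Real.exp (2 * sstar) * A₀ := by
      have hpos : Real.exp (-2 * (0 - -sstar)) ≠ 0 := (Real.exp_pos _).ne'
      have : A₀ = Real.exp (-2 * (0 - -sstar)) * sqSumLT D.k (D.coord (θ (-sstar, z))) := hform
      calc sqSumLT D.k (D.coord (θ (-sstar, z)))
          = Real.exp (2 * sstar) * (Real.exp (-2 * (0 - -sstar)) * sqSumLT D.k (D.coord (θ (-sstar, z)))) := by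
            rw [← mul_assoc, ← Real.exp_add, show 2 * sstar + -2 * (0 - -sstar) = 0 by ring,
              Real.exp_zero, one_mul]
        _ = Real.exp (2 * sstar) * A₀ := by rw [← this]
    have hgrow : (1 + 2 * sstar) * A₀ ≤ sqSumLT D.k (D.coord (θ (-sstar, z))) := by
      rw [hAstar]
      have h1 : 1 + 2 * sstar ≤ Real.exp (2 * sstar) := by
        have := Real.add_one_le_exp (2 * sstar); linarith
      exact mul_le_mul_of_nonneg_right h1 hA.le
    have hcalc : (1 + 2 * sstar) * A₀ = A₀ + D.ε ^ 2 := by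
      rw [hsstar]; field_simp
    have hlt : sqSumLT D.k (D.coord (θ (-sstar, z))) < D.ε ^ 2 := (hall sstar ⟨hsstar0, le_rfl⟩).2.1
    linarith
  -- the first backward exit time
  set Tset : Set ℝ := {s | s ∈ Icc 0 sstar ∧ θ (-s, z) ∉ D.box} with hTset
  have hTne : Tset.Nonempty := by obtain ⟨s, hs, hs'⟩ := hexit; exact ⟨s, hs, hs'⟩
  have hcontneg : Continuous fun s : ℝ => θ (-s, z) := (h.continuous_orbit z).comp continuous_neg
  have hTclosed : IsClosed Tset :=
    isClosed_Icc.inter (D.isOpen_box.isClosed_compl.preimage hcontneg)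
  have hTbdd : BddBelow Tset := ⟨0, fun s hs => hs.1.1⟩
  set t₂ : ℝ := sInf Tset with ht₂
  have ht₂mem : t₂ ∈ Tset := hTclosed.csInf_mem hTne hTbdd
  have hin : ∀ s ∈ Ico 0 t₂, θ (-s, z) ∈ D.box := fun s hs => by
    by_contra hs'
    have hsT : s ∈ Tset := ⟨⟨hs.1, hs.2.le.trans ht₂mem.1.2⟩, hs'⟩
    exact absurd (csInf_le hTbdd hsT) (not_le.2 hs.2)
  have ht₂pos : 0 < t₂ := by
    rcases ht₂mem.1.1.eq_or_lt with h0 | h0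
    · exfalso; apply ht₂mem.2; rw [← h0, neg_zero, h.map_zero]; exact hzbox
    · exact h0
  -- at `-t₂` the orbit is in the closed box
  have hclosed : θ (-t₂, z) ∈ {q' | q' ∈ D.chart.source ∧ sqSumLT D.k (D.coord q') ≤ D.ε ^ 2 ∧
      sqSumGE D.k (D.coord q') ≤ 4 * D.ε ^ 2} := by
    have := h.apply_mem_closedBox_of_forall_mem_box D (neg_lt_zero.2 ht₂pos) (t₂ := 0) fun s hs => by
      have := hin (-s) ⟨by linarith [hs.2], by linarith [hs.1]⟩
      simpa using this
    exact this.1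
  -- the closed box on `[-t₂, 0]`
  have hseg : ∀ r ∈ Icc (-t₂) 0, θ (r, z) ∈ {q' | q' ∈ D.chart.source ∧ sqSumLT D.k (D.coord q') ≤ D.ε ^ 2 ∧
      sqSumGE D.k (D.coord q') ≤ 4 * D.ε ^ 2} := by
    intro r hr
    rcases hr.1.eq_or_lt with h0 | h0
    · rw [← h0]; exact hclosed
    · have := hin (-r) ⟨by linarith [hr.2], by linarith⟩
      rw [neg_neg] at this
      exact D.box_subset_closedBox this
  have hsrc : ∀ r ∈ Icc (-t₂) 0, θ (r, z) ∈ D.chart.source := fun r hr => (hseg r hr).1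
  -- `B(-t₂) ≤ B₀ < 4ε²`, so the exit is through `A = ε²`
  have hBt : sqSumGE D.k (D.coord (θ (-t₂, z))) ≤ B₀ := by
    have hform := h.sqSumGE_coord_eq_exp D (neg_nonpos.2 ht₂pos.le) hsrc
    rw [h.map_zero] at hform
    -- `B₀ = e^{2 t₂} B(-t₂) ≥ B(-t₂)`
    have h1 : 1 ≤ Real.exp (2 * (0 - -t₂)) := Real.one_le_exp (by linarith)
    have hnn : 0 ≤ sqSumGE D.k (D.coord (θ (-t₂, z))) := sqSumGE_nonneg _ _
    have : B₀ = Real.exp (2 * (0 - -t₂)) * sqSumGE D.k (D.coord (θ (-t₂, z))) := hform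
    nlinarith
  have hAt : sqSumLT D.k (D.coord (θ (-t₂, z))) = D.ε ^ 2 := by
    rcases hclosed.2.1.eq_or_lt with h0 | h0
    · exact h0
    · exfalso; apply ht₂mem.2
      exact ⟨hclosed.1, h0, lt_of_le_of_lt hBt hBz⟩
  -- `f(-t₂) < f c - η ≤ f(0)`: intermediate value theorem on `[-t₂, 0]`
  have hft : f (θ (-t₂, z)) < f c - η := by
    rw [D.apply_eq_sub_add hclosed.1, hAt]
    linarith
  have hf0 : f c - η ≤ f (θ (0, z)) := by rw [h.map_zero]; exact hfz
  have hcont : ContinuousOn (fun r => f (θ (r, z))) (Icc (-t₂) 0) :=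
    (hf.comp (h.continuous_orbit z)).continuousOn
  obtain ⟨t, ht, hteq⟩ := intermediate_value_Icc (neg_nonpos.2 ht₂pos.le) hcont ⟨hft.le, hf0⟩
  exact ⟨t, ht.2, fun r hr => hseg r ⟨ht.1.trans hr.1, hr.2⟩, hteq⟩

end MilnorBox

/-! ### Forward confinement of the unstable disc below a height -/

namespace MilnorBox

/-- **Forward confinement on the unstable disc below the top of the box.**  A point `w` of the
box with `A(w) = 0` whose orbit satisfies `f(θ(t, w)) < f c + 4ε²` for `t ∈ [0, T]` stays in the
box on `[0, T]`, with `A = 0` (inside the box `A ≡ 0` and `f = f c + B`, so `B < 4ε²`; the closed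
box is compact, so the orbit cannot leave). [cite: MilnorHCobordism1965, proof of Thm. 3.12 (PDF p. 18)] -/
theorem forall_mem_box_of_sqSumLT_eq_zero_of_lt [T2Space M] (D : MilnorBox (𝓡 4) f X c)
    (h : IsFlowOf (𝓡 4) X θ) {w : M} (hw : w ∈ D.box) (hA : sqSumLT D.k (D.coord w) = 0) {T : ℝ}
    (hlt : ∀ t ∈ Icc 0 T, f (θ (t, w)) < f c + 4 * D.ε ^ 2) :
    ∀ t ∈ Icc 0 T, θ (t, w) ∈ D.box ∧ sqSumLT D.k (D.coord (θ (t, w))) = 0 := by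
  have hε := D.eps_pos
  -- `A = 0` wherever the orbit has stayed in the chart domain
  have hA0 : ∀ t, 0 ≤ t → (∀ r ∈ Icc 0 t, θ (r, w) ∈ D.chart.source) →
      sqSumLT D.k (D.coord (θ (t, w))) = 0 := by
    intro t ht hsrc
    have := h.sqSumLT_coord_eq_exp D ht hsrc
    rw [h.map_zero, hA, mul_zero] at this
    exact this
  -- every time in `[0, T]` is a box time
  have hbox : ∀ t ∈ Icc 0 T, θ (t, w) ∈ D.box := by
    by_contra hcon
    push Not at hcon
    set Tset : Set ℝ := {s | s ∈ Icc 0 T ∧ θ (s, w) ∉ D.box} with hTset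
    have hTne : Tset.Nonempty := by obtain ⟨t, ht, hb⟩ := hcon; exact ⟨t, ht, hb⟩
    have hTclosed : IsClosed Tset :=
      isClosed_Icc.inter (D.isOpen_box.isClosed_compl.preimage (h.continuous_orbit w))
    have hTbdd : BddBelow Tset := ⟨0, fun s hs => hs.1.1⟩
    set t₂ : ℝ := sInf Tset with ht₂
    have ht₂mem : t₂ ∈ Tset := hTclosed.csInf_mem hTne hTbdd
    have hin : ∀ s ∈ Ico 0 t₂, θ (s, w) ∈ D.box := fun s hs => by
      by_contra hs'
      have hsT : s ∈ Tset := ⟨⟨hs.1, hs.2.le.trans ht₂mem.1.2⟩, hs'⟩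
      exact absurd (csInf_le hTbdd hsT) (not_le.2 hs.2)
    have ht₂pos : 0 < t₂ := by
      rcases ht₂mem.1.1.eq_or_lt with h0 | h0
      · exfalso; apply ht₂mem.2; rw [← h0, h.map_zero]; exact hw
      · exact h0
    have hclosed : θ (t₂, w) ∈ {q' | q' ∈ D.chart.source ∧ sqSumLT D.k (D.coord q') ≤ D.ε ^ 2 ∧
        sqSumGE D.k (D.coord q') ≤ 4 * D.ε ^ 2} :=
      (h.apply_mem_closedBox_of_forall_mem_box D ht₂pos fun s hs => hin s ⟨hs.1.le, hs.2⟩).2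
    have hsrc : ∀ r ∈ Icc 0 t₂, θ (r, w) ∈ D.chart.source := fun r hr => by
      rcases hr.2.eq_or_lt with h0 | h0
      · rw [h0]; exact hclosed.1
      · exact (hin r ⟨hr.1, h0⟩).1
    have hAt : sqSumLT D.k (D.coord (θ (t₂, w))) = 0 := hA0 t₂ ht₂pos.le hsrc
    have hBt : sqSumGE D.k (D.coord (θ (t₂, w))) < 4 * D.ε ^ 2 := by
      have hf := D.apply_eq_sub_add hclosed.1
      have := hlt t₂ ht₂mem.1
      rw [hf, hAt] at this
      linarith
    exact ht₂mem.2 ⟨hclosed.1, by rw [hAt]; positivity, hBt⟩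
  intro t ht
  exact ⟨hbox t ht, hA0 t ht.1 fun r hr => (hbox r ⟨hr.1, hr.2.trans ht.2⟩).1⟩

end MilnorBox

/-! ### Consequences for the global flow of a gradient-like field -/

section GlobalFlow

variable [IsManifold (𝓡 4) ∞ M] [T2Space M] [CompactSpace M]
  {ξ : Π x : M, TangentSpace (𝓡 4) x}
  {hξ : ContMDiff (𝓡 4) (𝓡 4).tangent ∞ fun x => (⟨x, ξ x⟩ : TangentBundle (𝓡 4) M)}

namespace MilnorBox

/-- **The level projection of a tube point, read in the box.**  For a point `z` of the chart
domain of an index-`2` box of `(f, ξ)` with `A(z) > 0`, `f z ≥ f c - η`, `B(z) ≤ B_max`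
(`0 < η`, `η + B_max < ε²`, the level `f c - η` regular): `z` hits the level `f c - η`, its
projection `π z` is a point `flow z t`, `t ≤ 0`, of its orbit, the orbit segment between them
lies in the closed box, and along it `A·B` and Gay–Kirby's tube function `𝒯` are conserved; on
the level `A(π z) = η + B(π z)`. [cite: MilnorHCobordism1965, proof of Thm. 3.12 (PDF p. 18); Thm. 4.1 (PDF p. 22)]
[cite: GayKirby2016, §4, Lemma 14] -/
theorem exists_levelProj_eq_flow (D : MilnorBox (𝓡 4) f ξ c) (hk : D.k = 2)
    (hgl : IsGradientLike (𝓡 4) f ξ) (hfM : IsMorse (𝓡 4) f) {η Bmax : ℝ} (hη : 0 < η)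
    (hsmall : η + Bmax < D.ε ^ 2) (hreg : ∀ x, f x = f c - η → ¬ IsMCriticalPt (𝓡 4) f x)
    {z : M} (hz : z ∈ D.chart.source) (hA : 0 < sqSumLT D.k (D.coord z)) (hfz : f c - η ≤ f z)
    (hB : sqSumGE D.k (D.coord z) ≤ Bmax) :
    ∃ t ≤ 0, Hits (flowθ hξ) f (f c - η) z ∧ levelProj hξ f (f c - η) z = flow hξ z t ∧
      (∀ r ∈ Icc t 0, flow hξ z r ∈ {q' | q' ∈ D.chart.source ∧ sqSumLT D.k (D.coord q') ≤ D.ε ^ 2 ∧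
        sqSumGE D.k (D.coord q') ≤ 4 * D.ε ^ 2}) ∧
      sqSumLT D.k (D.coord (flow hξ z t)) * sqSumGE D.k (D.coord (flow hξ z t)) =
        sqSumLT D.k (D.coord z) * sqSumGE D.k (D.coord z) ∧
      (∀ ε' κ η' : ℝ, TubeModel.tube ε' κ η' (D.coord (flow hξ z t)) = TubeModel.tube ε' κ η' (D.coord z)) ∧
      sqSumLT D.k (D.coord (flow hξ z t)) = η + sqSumGE D.k (D.coord (flow hξ z t)) := by
  have hθ : IsFlowOf (𝓡 4) ξ (flowθ hξ) := (isSmoothFlow_flow hξ).isFlowOf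
  obtain ⟨t, ht, hseg, hft⟩ := D.exists_backward_level hθ hfM.contMDiff.continuous hη hsmall hz hA hfz hB
  have hft' : f (flow hξ z t) = f c - η := hft
  have hhits : Hits (flowθ hξ) f (f c - η) z := ⟨t, hft⟩
  have hproj : levelProj hξ f (f c - η) z = flow hξ z t := by
    rw [← hgl.levelProj_flow hfM hξ hreg hhits t, hgl.levelProj_of_apply_eq hfM hξ hreg hft']
  have hsrc : ∀ r ∈ Icc t 0, flowθ hξ (r, z) ∈ D.chart.source := fun r hr => (hseg r hr).1
  have hP := hθ.sqSumLT_mul_sqSumGE_coord_eq D ht hsrc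
  have hAexp := hθ.sqSumLT_coord_eq_exp D ht hsrc
  simp only [flowθ, flow_zero] at hP hAexp
  have hAt : 0 < sqSumLT D.k (D.coord (flow hξ z t)) := by
    rcases (sqSumLT_nonneg D.k (D.coord (flow hξ z t))).eq_or_lt with h0 | h0
    · rw [← h0, mul_zero] at hAexp; exact absurd hAexp hA.ne'
    · exact h0
  have htube : ∀ ε' κ η' : ℝ, TubeModel.tube ε' κ η' (D.coord (flow hξ z t)) = TubeModel.tube ε' κ η' (D.coord z) := by
    intro ε' κ η'
    have := hθ.tube_coord_eq D hk ε' κ η' ht hsrc hAt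
    simpa [flowθ, flow_zero] using this.symm
  have hlevel : sqSumLT D.k (D.coord (flow hξ z t)) = η + sqSumGE D.k (D.coord (flow hξ z t)) := by
    have := D.apply_eq_sub_add (hseg t ⟨le_rfl, ht⟩).1
    rw [hft'] at this
    linarith
  exact ⟨t, ht, hhits, hproj, hseg, hP.symm, htube, hlevel⟩

/-- **Points of the unstable disc do not reach the level below the critical point**: for `w` in
the box with `A(w) = 0`, `f ≥ f c` along the whole orbit (backwards it stays on the disc,
`f = f c + B`; forwards `f` increases), so the orbit never meets `f = f c - η`, `η > 0`.
[cite: MilnorHCobordism1965, proof of Thm. 3.12 (PDF p. 18)] -/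
theorem not_hits_of_sqSumLT_eq_zero (D : MilnorBox (𝓡 4) f ξ c) (hgl : IsGradientLike (𝓡 4) f ξ)
    (hfM : IsMorse (𝓡 4) f) {η : ℝ} (hη : 0 < η) {w : M} (hw : w ∈ D.box)
    (hA : sqSumLT D.k (D.coord w) = 0) : ¬ Hits (flowθ hξ) f (f c - η) w := by
  have hθ : IsFlowOf (𝓡 4) ξ (flowθ hξ) := (isSmoothFlow_flow hξ).isFlowOf
  rintro ⟨t, ht⟩
  have ht' : f (flow hξ w t) = f c - η := ht
  have hfw : f w = f c + sqSumGE D.k (D.coord w) := by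
    rw [D.apply_eq_sub_add hw.1, hA]; ring
  rcases le_or_gt t 0 with hle | hgt
  · obtain ⟨hbox, hAt, hBt⟩ := D.forall_mem_box_of_sqSumLT_eq_zero hθ hw hA t hle
    have hf := D.apply_eq_sub_add hbox.1
    have : f (flowθ hξ (t, w)) = f c - η := ht
    rw [hf, hAt] at this
    linarith [sqSumGE_nonneg D.k (D.coord (flowθ hξ (t, w)))]
  · have hmono := hgl.monotone_comp_flow hfM hξ w hgt.le
    simp only [comp_apply, flow_zero] at hmono
    linarith [sqSumGE_nonneg D.k (D.coord w)]

end MilnorBox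

/-- **The non-hitting points of a band above the attaching level lie on the unstable discs.**
Let `D j` be Milnor boxes of `(f, ξ)` about the critical points `c j` of one level
`f (c j) = f₀`, such that every critical point with value in `[f₀ - η, f₀ + B₁)` is one of the
`c j`, and `B₁ ≤ 4 ε_j²`.  If `f₀ - η < f z < f₀ + B₁` and the orbit of `z` does not meet the
level `f₀ - η`, then `z` lies in one of the boxes with `A_j(z) = 0` (the backward limit of `z`
is a critical point with value in `[f₀ - η, f z]`, hence some `c j`; near it the orbit is on the
unstable disc, which is invariant). [cite: MilnorHCobordism1965, proof of Thm. 3.12, Cor. 3.3 / Thm. 3.4] -/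
theorem exists_mem_box_sqSumLT_eq_zero_of_not_hits {ι : Type*} {cpt : ι → M}
    (D : ∀ j, MilnorBox (𝓡 4) f ξ (cpt j)) (hgl : IsGradientLike (𝓡 4) f ξ) (hfM : IsMorse (𝓡 4) f)
    {f₀ η B₁ : ℝ} (hlev : ∀ j, f (cpt j) = f₀)
    (hcrit : ∀ q, IsMCriticalPt (𝓡 4) f q → f₀ - η ≤ f q → f q < f₀ + B₁ → ∃ j, q = cpt j)
    (hB₁ : ∀ j, B₁ ≤ 4 * (D j).ε ^ 2) {z : M} (hz₁ : f₀ - η < f z) (hz₂ : f z < f₀ + B₁)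
    (hnot : ¬ Hits (flowθ hξ) f (f₀ - η) z) :
    ∃ j, z ∈ (D j).box ∧ sqSumLT (D j).k ((D j).coord z) = 0 := by
  have hθ : IsFlowOf (𝓡 4) ξ (flowθ hξ) := (isSmoothFlow_flow hξ).isFlowOf
  have hcontf : Continuous f := hfM.contMDiff.continuous
  -- `f > f₀ - η` along the orbit
  have habove : ∀ t, f₀ - η < f (flow hξ z t) := by
    intro t
    by_contra hle
    push Not at hle
    rcases le_or_gt t 0 with ht | ht
    · have hcont : ContinuousOn (fun r => f (flow hξ z r)) (Icc t 0) :=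
        (hcontf.comp (continuous_flow hξ z)).continuousOn
      obtain ⟨r, -, hr⟩ := intermediate_value_Icc ht hcont ⟨hle, by rw [flow_zero]; exact hz₁.le⟩
      exact hnot ⟨r, hr⟩
    · have hmono := hgl.monotone_comp_flow hfM hξ z ht.le
      simp only [comp_apply, flow_zero] at hmono
      linarith
  -- the backward limit
  obtain ⟨r, hrcrit, hrlim⟩ := hgl.exists_isMCriticalPt_tendsto_flow_atBot hfM hξ z
  have hflim : Tendsto (fun t => f (flow hξ z t)) atBot (𝓝 (f r)) := (hcontf.tendsto r).comp hrlim
  have hr₁ : f₀ - η ≤ f r := ge_of_tendsto' hflim fun t => (habove t).le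
  have hr₂ : f r ≤ f z := by
    have hmono := hgl.monotone_comp_flow hfM hξ z
    have : ∀ᶠ t in atBot, f (flow hξ z t) ≤ f z := by
      filter_upwards [eventually_le_atBot (0 : ℝ)] with t ht
      have := hmono ht
      simpa [comp_apply, flow_zero] using this
    exact le_of_tendsto hflim this
  obtain ⟨j, rfl⟩ := hcrit r hrcrit hr₁ (hr₂.trans_lt hz₂)
  -- near the limit the orbit is on the unstable disc
  obtain ⟨T₀, hT₀box, hT₀A⟩ := (D j).exists_mem_box_sqSumLT_eq_zero_of_tendsto_atBot hθ (x := z) hrlim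
  refine ⟨j, ?_⟩
  rcases le_or_gt 0 T₀ with hT | hT
  · -- backward confinement from `θ(T₀, z)` down to time `-T₀`
    obtain ⟨hbox, hA, -⟩ := (D j).forall_mem_box_of_sqSumLT_eq_zero hθ hT₀box hT₀A (-T₀) (by linarith)
    rw [hθ.map_neg_map] at hbox hA
    exact ⟨hbox, hA⟩
  · -- forward confinement from `w = θ(T₀, z)` up to time `-T₀`, below `f z < f₀ + B₁ ≤ f c + 4ε²`
    have hlt : ∀ t ∈ Icc 0 (-T₀), f (flowθ hξ (t, flowθ hξ (T₀, z))) < f (cpt j) + 4 * (D j).ε ^ 2 := by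
      intro t ht
      rw [hθ.map_add]
      have hmono := hgl.monotone_comp_flow hfM hξ z (show t + T₀ ≤ 0 by linarith [ht.2])
      simp only [comp_apply, flow_zero] at hmono
      have : f (flowθ hξ (t + T₀, z)) = f (flow hξ z (t + T₀)) := rfl
      rw [this, hlev j]
      linarith [hB₁ j]
    obtain ⟨hbox, hA⟩ := (D j).forall_mem_box_of_sqSumLT_eq_zero_of_lt hθ hT₀box hT₀A hlt (-T₀)
      ⟨by linarith, le_rfl⟩
    rw [hθ.map_neg_map] at hbox hA
    exact ⟨hbox, hA⟩

end GlobalFlow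

end Literature.Topology.FourManifolds

end
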